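import Summits.AtomisticToContinuum.FouriersLaw.Theses.EmbeddedDrudeMourre
import Summits.AtomisticToContinuum.FouriersLaw.Theorems.EmbeddedDrudeMourreAbelOfSpectralDensity
import Summits.AtomisticToContinuum.FouriersLaw.Theorems.EmbeddedDrudeMourreGreenKuboContinuationCanonicalSpectralMeasure
import Summits.AtomisticToContinuum.FouriersLaw.Theorems.EmbeddedDrudeMourreGreenKuboContinuationFilterInvariance
import Summits.AtomisticToContinuum.FouriersLaw.Theorems.EmbeddedDrudeMourreGreenKuboContinuationOrthonormalPolySeqExists
import Summits.AtomisticToContinuum.FouriersLaw.Theorems.EmbeddedDrudeMourreGreenKuboContinuationMateNevai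
import HarnessLib

/-!
# Bounded-variation Jacobi coefficients of the band-limited spectral measure ⇒ the Poisson–Abel limit
# at frequency `0`; and `GreenKuboContinuation` (stmt-AtomisticToContinuum-12597) from the
# no-dimerisation hypothesis of line `FilterInvariance` (card `band-limited-krylov-dimerisation`)

`--supports` file of the continuation lead c7 (2026-08-16). The line `FilterInvariance` reduced the crux
`EmbeddedDrudeMourre.GreenKuboContinuation` to the conjecture-grade stub S4 `stub_noKrylovDimerisation`
(skeleton rev 8 of this lead registers S4 and the engine S6 `stub_abelOfBandLimit`, proved HERE); its
four earlier stubs are tree theorems (S1 `stub_canonicalSpectralMeasure` p121052, S2 `stub_filterInvariance`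
p121062, S3 `stub_mateNevaiBoundedVariation` p124037 — the Máté–Nevai bounded-variation theorem, proved in
the tree —, S5 `stub_orthonormalPolySeq_exists` p121304). This file lands the line's COMPOSITION sorry-free,
in two layers, without new definitions (the weight `ψ(ω) = ((1 - ω²)₊)²` and the band-limited measure
`ψ · σ = σ.withDensity (ofReal ∘ ψ)` are written out):

* `stub_abelOfBandLimit` (registered stub S6; proved here) — the ABSTRACT, chain-free engine of the
  line: for a finite even measure `σ` on `ℝ`, if the band-limited measure `ψ · σ` carries an orthonormal polynomial
  sequence whose Jacobi coefficients `a_{n+1} = k_n / k_{n+1}` tend to `1/2` with `Σ |a_{n+2} - a_{n+1}| < ∞`,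
  then `ψ · σ` has a continuous strictly positive density `g` on `(-1, 1)` and the Poisson–Abel means of `σ`
  ITSELF converge: `∫ ν/(ν²+ω²) dσ(ω) → π g(0) > 0` as `ν ↓ 0` (Máté–Nevai + filter invariance + the route
  support `AbelOfSpectralDensity`); `tendsto_abel_of_bandLimit` is the time-side form for
  `C(t) = ∫ cos(ωt) dσ`: `∫₀^∞ e^{-νt} C(t) dt → π g(0)`.
* `greenKuboContinuation_of_noKrylovDimerisation` — the conditional closure of the crux: the registered
  signature of S4, taken as a hypothesis, implies `EmbeddedDrudeMourre.GreenKuboContinuation` (the canonical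
  pair of S1 is the witness at every `T > 0`, `κ = T⁻² π g_T(0)`; the corner hypothesis is discarded, as in
  `greenKuboContinuation_of_canonicalAbelLimit`, p117235).

What this file does NOT claim: S4 itself. S4 asserts, at EVERY parameter point `(ω₂, lam, β) > 0` and EVERY
`T > 0`, that the canonical current spectral measure charges all of `[-1, 1]` (Blumenthal–Weyl: `a_n → 1/2`
forces `supp (ψ·σ_T) = [-1, 1]`) with a continuous strictly positive density on the open band — a strict
strengthening of the all-`T` Abelian Green–Kubo statement (which reads `σ_T` at frequency `0` only), for
which no theorem exists for any interacting lattice current (see the line's DEAD note).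
-/

noncomputable section

namespace Summit.AtomisticToContinuum.FouriersLaw.Theorems.GreenKuboContinuation.BandLimitedKrylov

open Filter Topology MeasureTheory Set Polynomial
open Literature.MathematicalPhysics.KineticTheory.HeatConduction

/-! ## The weight `ψ(ω) = ((1 - ω²)₊)²`, written out -/

/-- `ψ` is continuous. [folklore] -/
theorem nkd_continuous_psi : Continuous fun ω : ℝ => (max (1 - ω ^ 2) 0) ^ 2 := by
  fun_prop

/-- `ψ` is measurable. [folklore] -/
theorem nkd_measurable_psi : Measurable fun ω : ℝ => (max (1 - ω ^ 2) 0) ^ 2 :=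
  nkd_continuous_psi.measurable

/-- `0 ≤ ψ`. [folklore] -/
theorem nkd_psi_nonneg (ω : ℝ) : 0 ≤ (max (1 - ω ^ 2) 0) ^ 2 := by
  positivity

/-- `ψ ≤ 1`. [folklore] -/
theorem nkd_psi_le_one (ω : ℝ) : (max (1 - ω ^ 2) 0) ^ 2 ≤ 1 := by
  have h0 : 0 ≤ max (1 - ω ^ 2) 0 := le_max_right _ _
  have h1 : max (1 - ω ^ 2) 0 ≤ 1 := max_le (by nlinarith [sq_nonneg ω]) zero_le_one
  nlinarith

/-- `ψ 0 = 1`. [folklore] -/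
theorem nkd_psi_zero : (max (1 - (0 : ℝ) ^ 2) 0) ^ 2 = 1 := by
  norm_num

/-- `ψ` is even. [folklore] -/
theorem nkd_psi_neg (ω : ℝ) : (max (1 - (-ω) ^ 2) 0) ^ 2 = (max (1 - ω ^ 2) 0) ^ 2 := by
  rw [neg_sq]

/-- `ψ` vanishes off `[-1, 1]`. [folklore] -/
theorem nkd_psi_eq_zero_of_not_mem {ω : ℝ} (h : ω ∉ Set.Icc (-1 : ℝ) 1) :
    (max (1 - ω ^ 2) 0) ^ 2 = 0 := by
  have h1 : 1 - ω ^ 2 ≤ 0 := by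
    rcases not_and_or.1 (fun hh => h ⟨hh.1, hh.2⟩) with h' | h'
    · have h'' : ω < -1 := lt_of_not_ge h'
      nlinarith
    · have h'' : 1 < ω := lt_of_not_ge h'
      nlinarith
  simp [max_eq_right h1]

/-- Measurability of the `ℝ≥0∞`-valued density `ofReal ∘ ψ`. [folklore] -/
theorem nkd_measurable_ofReal_psi :
    Measurable fun ω : ℝ => ENNReal.ofReal ((max (1 - ω ^ 2) 0) ^ 2) :=
  ENNReal.measurable_ofReal.comp nkd_measurable_psi

/-! ## The band-limited measure `ψ · σ` -/

/-- `ψ · σ` is a finite measure (`ψ ≤ 1`). [folklore] -/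
theorem nkd_isFiniteMeasure_bandLimit (σ : Measure ℝ) [IsFiniteMeasure σ] :
    IsFiniteMeasure (σ.withDensity fun ω : ℝ => ENNReal.ofReal ((max (1 - ω ^ 2) 0) ^ 2)) := by
  refine isFiniteMeasure_withDensity ?_
  have h : ∫⁻ ω, ENNReal.ofReal ((max (1 - ω ^ 2) 0) ^ 2) ∂σ ≤ ∫⁻ _ω, 1 ∂σ := by
    refine lintegral_mono fun ω => ?_
    calc ENNReal.ofReal ((max (1 - ω ^ 2) 0) ^ 2)
        ≤ ENNReal.ofReal 1 := ENNReal.ofReal_le_ofReal (nkd_psi_le_one ω)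
      _ = 1 := ENNReal.ofReal_one
  refine ne_of_lt (lt_of_le_of_lt h ?_)
  rw [lintegral_const, one_mul]
  exact measure_lt_top σ _

/-- `ψ · σ` is carried by `[-1, 1]`. [folklore] -/
theorem nkd_bandLimit_compl_Icc (σ : Measure ℝ) :
    σ.withDensity (fun ω : ℝ => ENNReal.ofReal ((max (1 - ω ^ 2) 0) ^ 2)) (Set.Icc (-1 : ℝ) 1)ᶜ = 0 := by
  rw [withDensity_apply _ (measurableSet_Icc.compl)]
  refine (lintegral_eq_zero_iff nkd_measurable_ofReal_psi).2 ?_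
  rw [Filter.EventuallyEq, ae_restrict_iff' (measurableSet_Icc.compl)]
  exact Eventually.of_forall fun ω hω => by simp [nkd_psi_eq_zero_of_not_mem hω]

/-- `ψ · σ` is even when `σ` is. [folklore] -/
theorem nkd_map_neg_bandLimit (σ : Measure ℝ) [IsFiniteMeasure σ]
    (hσ : σ.map (fun ω : ℝ => -ω) = σ) :
    (σ.withDensity fun ω : ℝ => ENNReal.ofReal ((max (1 - ω ^ 2) 0) ^ 2)).map (fun ω : ℝ => -ω) =
      σ.withDensity fun ω : ℝ => ENNReal.ofReal ((max (1 - ω ^ 2) 0) ^ 2) := by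
  have hme : Measurable fun ω : ℝ => -ω := measurable_neg
  ext s hs
  rw [Measure.map_apply hme hs, withDensity_apply _ (hme hs), withDensity_apply _ hs]
  have h1 : ∫⁻ ω in (fun ω : ℝ => -ω) ⁻¹' s, ENNReal.ofReal ((max (1 - ω ^ 2) 0) ^ 2) ∂σ =
      ∫⁻ ω in (fun ω : ℝ => -ω) ⁻¹' s, ENNReal.ofReal ((max (1 - ω ^ 2) 0) ^ 2)
        ∂(σ.map fun ω : ℝ => -ω) := by
    rw [hσ]
  rw [h1, setLIntegral_map (hme hs) nkd_measurable_ofReal_psi hme]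
  have hss : (fun ω : ℝ => -ω) ⁻¹' ((fun ω : ℝ => -ω) ⁻¹' s) = s := by ext; simp
  simp only [nkd_psi_neg, hss]

/-- Integration against `ψ · σ` is integration of `· ψ` against `σ`. [folklore] -/
theorem nkd_integral_bandLimit (σ : Measure ℝ) (f : ℝ → ℝ) :
    ∫ ω, f ω ∂(σ.withDensity fun ω : ℝ => ENNReal.ofReal ((max (1 - ω ^ 2) 0) ^ 2)) =
      ∫ ω, f ω * (max (1 - ω ^ 2) 0) ^ 2 ∂σ := by
  rw [integral_withDensity_eq_integral_toReal_smul nkd_measurable_ofReal_psi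
    (Eventually.of_forall fun _ => ENNReal.ofReal_lt_top)]
  refine integral_congr_ae (Eventually.of_forall fun ω => ?_)
  simp only [ENNReal.toReal_ofReal (nkd_psi_nonneg ω), smul_eq_mul, mul_comm]

/-! ## The abstract engine of the line: BV Jacobi coefficients of `ψ · σ` ⇒ Poisson–Abel limit of `σ` -/

/-- **S6 `stub_abelOfBandLimit` — bounded-variation Jacobi coefficients of the band-limited measure give
the Poisson–Abel limit at frequency `0`** (registered stub of line `FilterInvariance`; the line's abstract,
chain-free engine). Let `σ` be a finite even measure on `ℝ` and let `p` be an orthonormal polynomial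
sequence of the band-limited measure `ψ · σ`, `ψ(ω) = ((1 - ω²)₊)²` (`deg p_n = n`, positive leading
coefficients `k_n`), whose Jacobi coefficients `a_{n+1} = k_n / k_{n+1}` tend to `1/2` with
`Σ |a_{n+2} - a_{n+1}| < ∞`. Then `ψ · σ` has a continuous strictly positive density `g` on `(-1, 1)`
(Máté–Nevai, `stub_mateNevaiBoundedVariation`), and the Poisson–Abel means of `σ` ITSELF converge to
`π g(0)`: `∫ ν/(ν²+ω²) dσ(ω) → π g(0)` as `ν ↓ 0` (route support `AbelOfSpectralDensity` applied to `ψ · σ`,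
Fubini `integral_exp_neg_mul_cosTransform`, then filter invariance `stub_filterInvariance`, `ψ(0) = 1`).
[folklore] -/
theorem stub_abelOfBandLimit :
    ∀ σ : Measure ℝ, IsFiniteMeasure σ → σ.map (fun ω : ℝ => -ω) = σ →
      ∀ p : ℕ → Polynomial ℝ,
        (∀ n, (p n).natDegree = n) → (∀ n, 0 < (p n).leadingCoeff) →
        (∀ m n, ∫ ω, (p m).eval ω * (p n).eval ω
            ∂(σ.withDensity (fun ω : ℝ => ENNReal.ofReal ((max (1 - ω ^ 2) 0) ^ 2))) =
          if m = n then 1 else 0) →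
        Tendsto (fun n => (p n).leadingCoeff / (p (n + 1)).leadingCoeff) atTop (𝓝 (1 / 2)) →
        Summable (fun n => |(p (n + 1)).leadingCoeff / (p (n + 2)).leadingCoeff -
          (p n).leadingCoeff / (p (n + 1)).leadingCoeff|) →
        ∃ g : ℝ → ℝ, ContinuousOn g (Set.Ioo (-1) 1) ∧ (∀ ω ∈ Set.Ioo (-1 : ℝ) 1, 0 < g ω) ∧
          (σ.withDensity (fun ω : ℝ => ENNReal.ofReal ((max (1 - ω ^ 2) 0) ^ 2))).restrict
              (Set.Ioo (-1) 1) =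
            (volume.restrict (Set.Ioo (-1) 1)).withDensity (fun ω => ENNReal.ofReal (g ω)) ∧
          Tendsto (fun ν : ℝ => ∫ ω, ν / (ν ^ 2 + ω ^ 2) ∂σ) (𝓝[>] (0 : ℝ))
            (𝓝 (Real.pi * g 0)) := by
  intro σ hσfin hσeven p hdeg hlc horth hlim hbv
  haveI : IsFiniteMeasure σ := hσfin
  -- the band-limited measure
  set τ : Measure ℝ := σ.withDensity fun ω : ℝ => ENNReal.ofReal ((max (1 - ω ^ 2) 0) ^ 2) with hτ_def
  haveI hτfin : IsFiniteMeasure τ := nkd_isFiniteMeasure_bandLimit σ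
  have hτeven : τ.map (fun ω : ℝ => -ω) = τ := nkd_map_neg_bandLimit σ hσeven
  have hτsupp : τ (Set.Icc (-(1 : ℝ)) 1)ᶜ = 0 := nkd_bandLimit_compl_Icc σ
  -- Máté–Nevai: a continuous positive density on `(-1, 1)`
  obtain ⟨g, hgc, hgpos, hτg⟩ := stub_mateNevaiBoundedVariation τ 1 hτfin one_pos hτeven hτsupp p hdeg
    hlc horth (by simpa using hlim) hbv
  have hg0 : ∀ ω ∈ Set.Ioo (-(1 : ℝ)) 1, 0 ≤ g ω := fun ω hω => (hgpos ω hω).le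
  -- Abel limit of the band-limited measure on the time side (route support `AbelOfSpectralDensity`)
  have hA := Summit.AtomisticToContinuum.FouriersLaw.Theorems.AbelOfSpectralDensity.abelOfSpectralDensity_proof
  have hAbelτ : Tendsto (fun ν : ℝ => ∫ t in Ioi (0 : ℝ), Real.exp (-(ν * t)) *
      ∫ ω, Real.cos (ω * t) ∂τ) (𝓝[>] (0 : ℝ)) (𝓝 (Real.pi * g 0)) :=
    hA τ (fun t => ∫ ω, Real.cos (ω * t) ∂τ) 1 g hτfin one_pos (fun _ => rfl) hgc hg0 hτg
  -- … and on the frequency side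
  have hPoissonτ : Tendsto (fun ν : ℝ => ∫ ω, ν / (ν ^ 2 + ω ^ 2) ∂τ) (𝓝[>] (0 : ℝ))
      (𝓝 (Real.pi * g 0)) := by
    refine hAbelτ.congr' ?_
    filter_upwards [self_mem_nhdsWithin] with ν hν
    exact Summit.AtomisticToContinuum.FouriersLaw.Theorems.AbelOfSpectralDensity.integral_exp_neg_mul_cosTransform
      τ hν
  -- the frequency side of `τ` is the filtered Poisson integral of `σ`
  have hfilt : Tendsto (fun ν : ℝ => ∫ ω, ν / (ν ^ 2 + ω ^ 2) * (max (1 - ω ^ 2) 0) ^ 2 ∂σ)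
      (𝓝[>] (0 : ℝ)) (𝓝 (Real.pi * g 0)) := by
    refine hPoissonτ.congr' (Eventually.of_forall fun ν => ?_)
    exact nkd_integral_bandLimit σ (fun ω => ν / (ν ^ 2 + ω ^ 2))
  -- filter invariance moves the limit to `σ`
  have hPoissonσ : Tendsto (fun ν : ℝ => ∫ ω, ν / (ν ^ 2 + ω ^ 2) ∂σ) (𝓝[>] (0 : ℝ))
      (𝓝 (Real.pi * g 0)) :=
    (stub_filterInvariance σ (fun ω : ℝ => (max (1 - ω ^ 2) 0) ^ 2) ‹IsFiniteMeasure σ›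
      nkd_measurable_psi nkd_psi_nonneg nkd_psi_le_one nkd_continuous_psi.continuousAt nkd_psi_zero
      (Real.pi * g 0)).2 hfilt
  exact ⟨g, hgc, hgpos, hτg, hPoissonσ⟩

/-- **Time-side form.** Under the hypotheses of `stub_abelOfBandLimit`, the
Abel means of the cosine transform `C(t) = ∫ cos(ωt) dσ(ω)` converge to a strictly positive limit:
`∫₀^∞ e^{-νt} C(t) dt → L > 0` as `ν ↓ 0` (`L = π g(0)`; Fubini `integral_exp_neg_mul_cosTransform`).
[folklore] -/
theorem tendsto_abel_of_bandLimit (σ : Measure ℝ) [IsFiniteMeasure σ]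
    (hσeven : σ.map (fun ω : ℝ => -ω) = σ) (C : ℝ → ℝ)
    (hC : ∀ t : ℝ, C t = ∫ ω, Real.cos (ω * t) ∂σ) (p : ℕ → ℝ[X])
    (hdeg : ∀ n, (p n).natDegree = n) (hlc : ∀ n, 0 < (p n).leadingCoeff)
    (horth : ∀ m n, ∫ ω, (p m).eval ω * (p n).eval ω
        ∂(σ.withDensity fun ω : ℝ => ENNReal.ofReal ((max (1 - ω ^ 2) 0) ^ 2)) =
      if m = n then 1 else 0)
    (hlim : Tendsto (fun n => (p n).leadingCoeff / (p (n + 1)).leadingCoeff) atTop (𝓝 (1 / 2)))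
    (hbv : Summable (fun n => |(p (n + 1)).leadingCoeff / (p (n + 2)).leadingCoeff -
      (p n).leadingCoeff / (p (n + 1)).leadingCoeff|)) :
    ∃ L : ℝ, 0 < L ∧
      Tendsto (fun ν : ℝ => ∫ t in Ioi (0 : ℝ), Real.exp (-(ν * t)) * C t) (𝓝[>] (0 : ℝ)) (𝓝 L) := by
  obtain ⟨g, _hgc, hgpos, _hτg, hPoissonσ⟩ :=
    stub_abelOfBandLimit σ ‹IsFiniteMeasure σ› hσeven p hdeg hlc horth hlim hbv
  have hg00 : 0 < g 0 := hgpos 0 ⟨by norm_num, by norm_num⟩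
  refine ⟨Real.pi * g 0, by positivity, ?_⟩
  refine hPoissonσ.congr' ?_
  filter_upwards [self_mem_nhdsWithin] with ν hν
  have hfun : (fun t : ℝ => Real.exp (-(ν * t)) * C t) =
      fun t : ℝ => Real.exp (-(ν * t)) * ∫ ω, Real.cos (ω * t) ∂σ := by
    funext t; rw [hC t]
  rw [hfun]
  exact (Summit.AtomisticToContinuum.FouriersLaw.Theorems.AbelOfSpectralDensity.integral_exp_neg_mul_cosTransform
    σ hν).symm

/-! ## The conditional closure of the crux -/

/-- **`GreenKuboContinuation` from the no-dimerisation hypothesis (S4 of line `FilterInvariance`).**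
If, for `pinnedChain ω₂ lam β γ` (all `> 0`), every dynamics `D` with carrier `bmGood`, every `T > 0`,
every shift-invariant DLR state `μ` at `T` preserved by `D` and every finite even measure `σ` with
`C_{D,μ}(t) = ∫ cos(ωt) dσ`, the band-limited measure `((1-ω²)₊)² · σ` has infinite support and every
orthonormal polynomial sequence of it has Jacobi coefficients `a_{n+1} = k_n/k_{n+1} → 1/2` of bounded
variation (this is the REGISTERED signature of `stub_noKrylovDimerisation`, verbatim), then
`EmbeddedDrudeMourre.GreenKuboContinuation` holds: the canonical pair of `stub_canonicalSpectralMeasure`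
is an Abelian Green–Kubo witness at every `T > 0` with `κ = T⁻² π g_T(0) > 0`
(`stub_orthonormalPolySeq_exists` + `tendsto_abel_of_bandLimit`); the corner hypothesis of the crux is
not used. [folklore] -/
theorem greenKuboContinuation_of_noKrylovDimerisation
    (h : ∀ ω₂ lam β γ : ℝ, 0 < ω₂ → 0 < lam → 0 < β → 0 < γ →
      ∀ D : InfiniteChainDynamics (pinnedChain ω₂ lam β γ),
        D.carrier = (pinnedChain ω₂ lam β γ).bmGood →
        ∀ T : ℝ, 0 < T → ∀ (μ : Measure ChainConfig) (σ : Measure ℝ),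
          (pinnedChain ω₂ lam β γ).IsChainGibbsMeasure T μ → IsShiftInvariant μ →
          D.PreservesMeasure μ → IsFiniteMeasure σ → σ.map (fun ω : ℝ => -ω) = σ →
          (∀ t : ℝ, D.currentCorrelation μ t = ∫ ω, Real.cos (ω * t) ∂σ) →
          (∀ s : Finset ℝ,
            σ.withDensity (fun ω : ℝ => ENNReal.ofReal ((max (1 - ω ^ 2) 0) ^ 2)) (↑s : Set ℝ)ᶜ ≠ 0) ∧
          ∀ p : ℕ → Polynomial ℝ,
            (∀ n, (p n).natDegree = n) → (∀ n, 0 < (p n).leadingCoeff) →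
            (∀ m n, ∫ ω, (p m).eval ω * (p n).eval ω
                ∂(σ.withDensity (fun ω : ℝ => ENNReal.ofReal ((max (1 - ω ^ 2) 0) ^ 2))) =
              if m = n then 1 else 0) →
            Tendsto (fun n => (p n).leadingCoeff / (p (n + 1)).leadingCoeff) atTop (𝓝 (1 / 2)) ∧
            Summable (fun n => |(p (n + 1)).leadingCoeff / (p (n + 2)).leadingCoeff -
              (p n).leadingCoeff / (p (n + 1)).leadingCoeff|)) :
    Summit.AtomisticToContinuum.FouriersLaw.Theses.EmbeddedDrudeMourre.GreenKuboContinuation := by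
  unfold Summit.AtomisticToContinuum.FouriersLaw.Theses.EmbeddedDrudeMourre.GreenKuboContinuation
  intro ω₂ lam β γ hω hl hβ hγ _T₀ _hT₀ _hcorner T hT
  -- S1: the canonical pair and its even spectral measure
  obtain ⟨D, hcar, hfam⟩ := stub_canonicalSpectralMeasure ω₂ lam β γ hω hl hβ hγ
  obtain ⟨μ, σ, hG, hS, hP, hAC, hσfin, hσeven, hC⟩ := hfam T hT
  haveI : IsFiniteMeasure σ := hσfin
  -- S4 (hypothesis): infinite support and bounded-variation Jacobi coefficients of `ψ · σ`
  obtain ⟨hinf, hasymp⟩ := h ω₂ lam β γ hω hl hβ hγ D hcar T hT μ σ hG hS hP hσfin hσeven hC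
  -- S5: an orthonormal polynomial sequence of `ψ · σ`
  obtain ⟨p, hdeg, hlc, horth⟩ := stub_orthonormalPolySeq_exists
    (σ.withDensity fun ω : ℝ => ENNReal.ofReal ((max (1 - ω ^ 2) 0) ^ 2)) 1
    (nkd_isFiniteMeasure_bandLimit σ) (nkd_bandLimit_compl_Icc σ) hinf
  obtain ⟨hlim, hbv⟩ := hasymp p hdeg hlc horth
  -- the engine
  obtain ⟨L, hL, hAbel⟩ := tendsto_abel_of_bandLimit σ hσeven (D.currentCorrelation μ) hC p hdeg hlc
    horth hlim hbv
  exact ⟨μ, D, (T ^ 2)⁻¹ * L, hG, hP, hAC, by positivity, hAbel.const_mul ((T ^ 2)⁻¹)⟩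

end Summit.AtomisticToContinuum.FouriersLaw.Theorems.GreenKuboContinuation.BandLimitedKrylov

end
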